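import Summits.NavierStokesRegularity.NavierStokesRegularity.Theorems.HubbleDynamoNoSelfExcitedDynamoStubEnstrophyBalance
import Summits.NavierStokesRegularity.NavierStokesRegularity.Theorems.HubbleDynamoNoSelfExcitedDynamoStubBackwardGronwall
import Summits.NavierStokesRegularity.NavierStokesRegularity.Theorems.HubbleDynamoNoSelfExcitedDynamoStubCurlFreeLiouville
import Literature.Analysis.FluidPDE.AncientSimilarityVorticity
import HarnessLib

/-!
# Crux `NoSelfExcitedDynamo` (stmt-NavierStokesRegularity-1934), line `registered`: the Backus regime

Theorems file (lands `--supports stmt-NavierStokesRegularity-1934`, registered sub-goal `stub_backusRegime`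
= stub 4 of the registrar's birth skeleton, now UNCONDITIONAL): in the uniform profile class
`(1 + ‖y‖)^{k+1} ‖DᵏU(s, y)‖ ≤ K_k`, an ETERNAL classical solution `(U, P)` of Leray's backward system
`∂ₛU + ½U + ½(y·∇)U + (U·∇)U + ∇P = ΔU`, `div U = 0` on `ℝ × ℝ³` (`IsBackwardLeraySolutionOn univ 1 U P`)
with amplitude below Leray's constant, `‖U(s, y)‖ ≤ C₀ < 1`, vanishes identically — the nonlinear,
time-dependent twin of the route's `BackusRung` (magnetic Reynolds number `R_m = C₀²/(aν) < 2`,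
`a = ½`, `ν = 1`), i.e. "no self-excited dynamo in Hubble flow below Leray's constant".

## Proof

Composition of the three landed stubs of the line: `stub_enstrophyBalance` (the enstrophy
`E(s) = ∫‖curl U(s)‖²` is finite, bounded in `s`, and `E(s₁) − E(s₀) ≤ −½(1 − C₁²)∫_{s₀}^{s₁}E`, with
`C₁ = max C₀ 0`), `stub_backwardGronwall` (bounded + nonnegative + that increment inequality on all of
`ℝ` ⇒ `E ≡ 0`), the vanishing of a continuous nonnegative integrand with zero integral, and
`stub_curlFreeLiouville` (curl-free + divergence-free + bounded + decaying ⇒ `U ≡ 0`).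
-/

noncomputable section

-- the mandated stub namespace repeats `NavierStokesRegularity` (tree precedent for this crux's stubs)
set_option linter.dupNamespace false

namespace Summit.NavierStokesRegularity.NavierStokesRegularity.Theorems.NoSelfExcitedDynamo.Registered

open Set MeasureTheory Filter Topology
open scoped ContDiff
open Literature.Analysis.FluidPDE

/-- A continuous vector field on `ℝ³` with `∫ ‖Ω‖² = 0` (the integrand being integrable) vanishes
identically: Lebesgue measure charges the open set where `‖Ω‖² > 0`. -/
theorem backusRegime_eq_zero_of_integral_sq_norm_eq_zero
    {Ω : EuclideanSpace ℝ (Fin 3) → EuclideanSpace ℝ (Fin 3)}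
    (hΩ : Continuous Ω) (hint : Integrable (fun y => ‖Ω y‖ ^ 2) volume)
    (h0 : ∫ y, ‖Ω y‖ ^ 2 = 0) : ∀ y, Ω y = 0 := by
  by_contra hne
  push Not at hne
  obtain ⟨y₀, hy₀⟩ := hne
  have hpos : 0 < ∫ y, ‖Ω y‖ ^ 2 := by
    rw [integral_pos_iff_support_of_nonneg (fun y => sq_nonneg _) hint]
    have hopen : IsOpen (Function.support fun y => ‖Ω y‖ ^ 2) :=
      isOpen_ne_fun (hΩ.norm.pow 2) continuous_const
    refine hopen.measure_pos volume ⟨y₀, ?_⟩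
    simp [Function.mem_support, hy₀]
  linarith

/-- **The Backus regime** (registered sub-goal `stub_backusRegime` of crux
stmt-NavierStokesRegularity-1934; stub 4 of the birth skeleton, now a theorem): in the uniform profile
class, an eternal classical solution of the backward Leray system (`a = ½`, `ν = 1`) on `ℝ × ℝ³` with
`‖U(s, y)‖ ≤ C₀ < 1` for all `s, y` vanishes identically. With `C₁ = max C₀ 0 ∈ [0, 1)` the enstrophy
balance gives `E(s₁) − E(s₀) ≤ −½(1 − C₁²)∫_{s₀}^{s₁}E` for the bounded enstrophy
(`stub_enstrophyBalance`), the backward Grönwall lemma (`stub_backwardGronwall`) kills `E`, the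
continuous integrand `‖curl U(s)‖²` then vanishes pointwise, and the curl-free Liouville theorem
(`stub_curlFreeLiouville`) finishes. -/
theorem stub_backusRegime :
    ∀ (U : ℝ → EuclideanSpace ℝ (Fin 3) → EuclideanSpace ℝ (Fin 3)) (P : ℝ → EuclideanSpace ℝ (Fin 3) → ℝ),
      IsBackwardLeraySolutionOn univ 1 U P →
      (∀ k : ℕ, ∃ K : ℝ, ∀ s y, (1 + ‖y‖) ^ (k + 1) * ‖iteratedFDeriv ℝ k (U s) y‖ ≤ K) →
      (∃ C₀ : ℝ, C₀ < 1 ∧ ∀ s y, ‖U s y‖ ≤ C₀) →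
      ∀ s y, U s y = 0 := by
  intro U P hL hprof hC
  obtain ⟨C₀, hC₀, hsup⟩ := hC
  -- normalise the constant: `0 ≤ C₁ < 1`
  set C₁ : ℝ := max C₀ 0 with hC₁
  have hC₁1 : C₁ < 1 := max_lt hC₀ one_pos
  have hsup' : ∀ s y, ‖U s y‖ ≤ C₁ := fun s y => (hsup s y).trans (le_max_left _ _)
  have hc : 0 < (1 - C₁ ^ 2) / 2 := by
    have hC₁0 : 0 ≤ C₁ := le_max_right _ _
    nlinarith
  obtain ⟨hint, ⟨M, hM⟩, hincr⟩ := stub_enstrophyBalance U P C₁ hL hprof hsup'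
  -- the enstrophy vanishes at every similarity time
  have hE : ∀ s, (∫ y, ‖curl (U s) y‖ ^ 2) = 0 :=
    stub_backwardGronwall (fun s => ∫ y, ‖curl (U s) y‖ ^ 2) ((1 - C₁ ^ 2) / 2) M hc
      (fun s => integral_nonneg fun y => sq_nonneg _) hM hincr
  -- hence the vorticity vanishes
  have hcurl : ∀ s y, curl (U s) y = 0 := by
    intro s
    have hUs : ContDiff ℝ ∞ (U s) := hL.smooth_velocity.contDiff_slice (mem_univ s)
    have hΩc : Continuous (curl (U s)) :=
      (contDiff_curl (n := 0) (hUs.of_le (by norm_cast))).continuous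
    exact backusRegime_eq_zero_of_integral_sq_norm_eq_zero hΩc (hint s) (hE s)
  exact stub_curlFreeLiouville U P hL hprof hcurl

end Summit.NavierStokesRegularity.NavierStokesRegularity.Theorems.NoSelfExcitedDynamo.Registered

end
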